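import Mathlib
import HarnessLib
import Summits.Ventures.LatticeQCDFlow.Exactness.U1DriftPlaquetteCalculus
import Summits.Ventures.LatticeQCDFlow.Exactness.U1SubstepLipschitz

/-!
# `U(1)` rung: VOLUME-INDEPENDENT bounds for the pieces of the pulled-back force — the plaquette-incidence count `8(d−1)` and the entries `M`, `N` of `DZ`, `DC`

HONEST FRAMING: exact (Metropolis-corrected) sampling algorithms for lattice gauge theory;
figures of merit are autocorrelation/cost numbers at stated couplings and volumes; no
continuum-physics claim.

Venture `LatticeQCDFlow` (cell pub-lqcd), topic `Exactness`; FANOUT row 14 (`eng-flowhmc`, engine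
`latflow.fthmc`, family B, `U(1)` rung).  NEW WORK of the cell over this row's
`U1DriftPlaquetteCalculus` (incidence numbers, the two translation counts) and GEN-12's
`U1SubstepLipschitz` (`abs_re_sub_re_le_dist`), GEN-12's `U1WilsonForceLipschitz`
(`abs_im_coe_circle_le`, `abs_im_sub_im_le_dist`) and row 29's `dist_plaquetteHolonomy_le`
(plaquettes are `4`-Lipschitz); nothing is cited as a fact;
no number.  Sub-step, field `Z`, factor `C` VERBATIM as in `exists_layers_u1WilsonFlowLO`; `M_e(V)(e')`,
`N_e(V)(e')` the incidence-weighted plaquette sums of `U1SubstepForceChainRule` /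
`U1SubstepLogJacobianForce` (the entries of the derivatives of `Z_e`, `C_e` along the drift).

* §1 **`sum_sum_abs_incidence_le`** — for every link `e'`:
  `Σ_e Σ_(ν ≠ μ_e) (|ℓ_(P⁻(e,ν))(δ_e')| + |ℓ_(P⁺(e,ν))(δ_e')|) ≤ 8(d−1)` — each of the eight corner
  families is a translate count `= d − 1` (`sum_ite_edge_translate_fst/snd`); THIS is where volume
  independence comes from;
* §2 `sum_abs_flowFieldEntry_le` (`Σ_e |M_e(V)(e')| ≤ 8(d−1)`), `sum_abs_flowFieldEntry_sub_le`
  (`Σ_e |M_e(V)(e') − M_e(V')(e')| ≤ 32(d−1)·dist(V,V')`), and the same two for `N`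
  (`sum_abs_factorEntry_le`, `sum_abs_factorEntry_sub_le`);
* the Lipschitz constants of the sub-step itself and of `C_e` are in the companion file
  `U1SubstepLipschitz`.

NOT CLAIMED: optimality of `8(d−1)` / `32(d−1)` (crude: `|Re|, |Im| ≤ 1`, plaquettes `4`-Lipschitz);
`SU(2)`; any number.
-/

noncomputable section

namespace Summit.Ventures.LatticeQCDFlow.Exactness

open Literature.MathematicalPhysics.QuantumFieldTheory Literature.MathematicalPhysics.QuantumLattice
open Summit.Ventures.LatticeQCDFlow.Theory2.Lattice (dist_plaquetteHolonomy_le)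
open scoped BigOperators

variable {d L : ℕ}

/-! ## §1 The plaquette-incidence count -/

section Incidence

variable [NeZero L]

/-- Corner count, own direction, for corners presented as `(g e ν, e.2)` with `g e ν = e.1 + τ e.2 ν`. -/
theorem sum_ite_corner_fst (τ : Fin d → Fin d → Site d L) (g : Edge d L → Fin d → Site d L)
    (hg : ∀ e ν, g e ν = e.1 + τ e.2 ν) (e' : Edge d L) :
    ∑ e : Edge d L, ∑ ν ∈ Finset.univ.erase e.2, (if (g e ν, e.2) = e' then (1 : ℝ) else 0) =
      ((d - 1 : ℕ) : ℝ) := by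
  classical
  simp_rw [hg]
  exact sum_ite_edge_translate_fst τ e'

/-- Corner count, transverse direction, for corners presented as `(g e ν, ν)` with `g e ν = e.1 + τ e.2 ν`. -/
theorem sum_ite_corner_snd (τ : Fin d → Fin d → Site d L) (g : Edge d L → Fin d → Site d L)
    (hg : ∀ e ν, g e ν = e.1 + τ e.2 ν) (e' : Edge d L) :
    ∑ e : Edge d L, ∑ ν ∈ Finset.univ.erase e.2, (if (g e ν, ν) = e' then (1 : ℝ) else 0) =
      ((d - 1 : ℕ) : ℝ) := by
  classical
  simp_rw [hg]
  exact sum_ite_edge_translate_snd τ e'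

/-- **THE INCIDENCE COUNT.**  For every link `e'`:
`Σ_e Σ_(ν ≠ μ_e) (|ℓ_(P⁻(e,ν))(δ_e')| + |ℓ_(P⁺(e,ν))(δ_e')|) ≤ 8(d−1)`. -/
theorem sum_sum_abs_incidence_le (e' : Edge d L) :
    ∑ e : Edge d L, ∑ ν ∈ Finset.univ.erase e.2,
      (|(Pi.single e' (1 : ℝ) : Edge d L → ℝ) (e.1 - Pi.single ν 1, e.2) +
          (Pi.single e' (1 : ℝ) : Edge d L → ℝ) ((e.1 - Pi.single ν 1).shift e.2, ν) -
          (Pi.single e' (1 : ℝ) : Edge d L → ℝ) ((e.1 - Pi.single ν 1).shift ν, e.2) -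
          (Pi.single e' (1 : ℝ) : Edge d L → ℝ) (e.1 - Pi.single ν 1, ν)| +
        |(Pi.single e' (1 : ℝ) : Edge d L → ℝ) (e.1, e.2) +
          (Pi.single e' (1 : ℝ) : Edge d L → ℝ) (e.1.shift e.2, ν) -
          (Pi.single e' (1 : ℝ) : Edge d L → ℝ) (e.1.shift ν, e.2) -
          (Pi.single e' (1 : ℝ) : Edge d L → ℝ) (e.1, ν)|) ≤ 8 * ((d - 1 : ℕ) : ℝ) := by
  classical
  have c1 := sum_ite_corner_fst (fun _ ν => -Pi.single ν (1 : ZMod L)) (fun e ν => e.1 - Pi.single ν 1)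
    (fun e ν => sub_eq_add_neg _ _) e'
  have c2 := sum_ite_corner_snd (fun μ ν => -Pi.single ν (1 : ZMod L) + Pi.single μ 1)
    (fun e ν => (e.1 - Pi.single ν 1).shift e.2) (fun e ν => by simp only [Site.shift]; abel) e'
  have c3 := sum_ite_corner_fst (fun _ ν => -Pi.single ν (1 : ZMod L) + Pi.single ν 1)
    (fun e ν => (e.1 - Pi.single ν 1).shift ν) (fun e ν => by simp only [Site.shift]; abel) e'
  have c4 := sum_ite_corner_snd (fun _ ν => -Pi.single ν (1 : ZMod L)) (fun e ν => e.1 - Pi.single ν 1)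
    (fun e ν => sub_eq_add_neg _ _) e'
  have c5 := sum_ite_corner_fst (fun _ _ => (0 : Site d L)) (fun e _ => e.1)
    (fun e ν => (add_zero _).symm) e'
  have c6 := sum_ite_corner_snd (fun μ _ => Pi.single μ (1 : ZMod L)) (fun e _ => e.1.shift e.2)
    (fun e ν => rfl) e'
  have c7 := sum_ite_corner_fst (fun _ ν => Pi.single ν (1 : ZMod L)) (fun e ν => e.1.shift ν)
    (fun e ν => rfl) e'
  have c8 := sum_ite_corner_snd (fun _ _ => (0 : Site d L)) (fun e _ => e.1)
    (fun e ν => (add_zero _).symm) e'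
  beta_reduce at c1 c2 c3 c4 c5 c6 c7 c8
  have hpt : ∀ (e : Edge d L) (ν : Fin d),
      |(Pi.single e' (1 : ℝ) : Edge d L → ℝ) (e.1 - Pi.single ν 1, e.2) +
          (Pi.single e' (1 : ℝ) : Edge d L → ℝ) ((e.1 - Pi.single ν 1).shift e.2, ν) -
          (Pi.single e' (1 : ℝ) : Edge d L → ℝ) ((e.1 - Pi.single ν 1).shift ν, e.2) -
          (Pi.single e' (1 : ℝ) : Edge d L → ℝ) (e.1 - Pi.single ν 1, ν)| +
        |(Pi.single e' (1 : ℝ) : Edge d L → ℝ) (e.1, e.2) +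
          (Pi.single e' (1 : ℝ) : Edge d L → ℝ) (e.1.shift e.2, ν) -
          (Pi.single e' (1 : ℝ) : Edge d L → ℝ) (e.1.shift ν, e.2) -
          (Pi.single e' (1 : ℝ) : Edge d L → ℝ) (e.1, ν)| ≤
      ((if (e.1 - Pi.single ν 1, e.2) = e' then 1 else 0) +
          (if ((e.1 - Pi.single ν 1).shift e.2, ν) = e' then 1 else 0) +
          (if ((e.1 - Pi.single ν 1).shift ν, e.2) = e' then 1 else 0) +
          (if (e.1 - Pi.single ν 1, ν) = e' then (1 : ℝ) else 0)) +
        ((if (e.1, e.2) = e' then 1 else 0) + (if (e.1.shift e.2, ν) = e' then 1 else 0) +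
          (if (e.1.shift ν, e.2) = e' then 1 else 0) + (if (e.1, ν) = e' then (1 : ℝ) else 0)) :=
    fun e ν => add_le_add (abs_incidence_single_le (e.1 - Pi.single ν 1) e.2 ν e')
      (abs_incidence_single_le e.1 e.2 ν e')
  refine (Finset.sum_le_sum fun e _ => Finset.sum_le_sum fun ν _ => hpt e ν).trans ?_
  simp only [Finset.sum_add_distrib]
  linarith [c1, c2, c3, c4, c5, c6, c7, c8]

end Incidence

/-! ## §2 The entries `M`, `N` of `DZ`, `DC`: sup and Lipschitz bounds, summed over links -/

section Entries

/-- Real bookkeeping: `|(ra − qa') − (r'a − q'a')| ≤ D(|a| + |a'|)` when `|r − r'|, |q − q'| ≤ D`. -/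
theorem abs_sub_sub_sub_le {r r' q q' a a' D : ℝ} (hr : |r - r'| ≤ D) (hq : |q - q'| ≤ D) :
    |(r * a - q * a') - (r' * a - q' * a')| ≤ D * (|a| + |a'|) := by
  have h : (r * a - q * a') - (r' * a - q' * a') = (r - r') * a - (q - q') * a' := by ring
  rw [h]
  refine (abs_sub _ _).trans ?_
  rw [abs_mul, abs_mul]
  have h1 := mul_le_mul_of_nonneg_right hr (abs_nonneg a)
  have h2 := mul_le_mul_of_nonneg_right hq (abs_nonneg a')
  linarith

/-- Real bookkeeping: `|(ra' + qa) − (r'a' + q'a)| ≤ D(|a| + |a'|)` when `|r − r'|, |q − q'| ≤ D`. -/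
theorem abs_add_sub_add_le {r r' q q' a a' D : ℝ} (hr : |r - r'| ≤ D) (hq : |q - q'| ≤ D) :
    |(r * a' + q * a) - (r' * a' + q' * a)| ≤ D * (|a| + |a'|) := by
  have h : (r * a' + q * a) - (r' * a' + q' * a) = (r - r') * a' + (q - q') * a := by ring
  rw [h]
  refine (abs_add_le _ _).trans ?_
  rw [abs_mul, abs_mul]
  have h1 := mul_le_mul_of_nonneg_right hr (abs_nonneg a')
  have h2 := mul_le_mul_of_nonneg_right hq (abs_nonneg a)
  linarith

/-- Real bookkeeping: `|ra − qa'| ≤ |a| + |a'|` when `|r|, |q| ≤ 1`. -/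
theorem abs_mul_sub_mul_le {r q a a' : ℝ} (hr : |r| ≤ 1) (hq : |q| ≤ 1) :
    |r * a - q * a'| ≤ |a| + |a'| := by
  refine (abs_sub _ _).trans ?_
  rw [abs_mul, abs_mul]
  have h1 := mul_le_mul_of_nonneg_right hr (abs_nonneg a)
  have h2 := mul_le_mul_of_nonneg_right hq (abs_nonneg a')
  linarith

/-- Real bookkeeping: `|ra' + qa| ≤ |a| + |a'|` when `|r|, |q| ≤ 1`. -/
theorem abs_mul_add_mul_le {r q a a' : ℝ} (hr : |r| ≤ 1) (hq : |q| ≤ 1) :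
    |r * a' + q * a| ≤ |a| + |a'| := by
  refine (abs_add_le _ _).trans ?_
  rw [abs_mul, abs_mul]
  have h1 := mul_le_mul_of_nonneg_right hr (abs_nonneg a')
  have h2 := mul_le_mul_of_nonneg_right hq (abs_nonneg a)
  linarith

variable [NeZero L]

/-- **`Σ_e |M_e(V)(e')| ≤ 8(d−1)`.** -/
theorem sum_abs_flowFieldEntry_le (V : GaugeConfig d L Circle) (e' : Edge d L) :
    ∑ e : Edge d L, |∑ ν ∈ Finset.univ.erase e.2,
        (((plaquetteHolonomy V (e.1 - Pi.single ν 1) e.2 ν : Circle) : ℂ).re *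
            ((Pi.single e' (1 : ℝ) : Edge d L → ℝ) (e.1 - Pi.single ν 1, e.2) +
              (Pi.single e' (1 : ℝ) : Edge d L → ℝ) ((e.1 - Pi.single ν 1).shift e.2, ν) -
              (Pi.single e' (1 : ℝ) : Edge d L → ℝ) ((e.1 - Pi.single ν 1).shift ν, e.2) -
              (Pi.single e' (1 : ℝ) : Edge d L → ℝ) (e.1 - Pi.single ν 1, ν)) -
          ((plaquetteHolonomy V e.1 e.2 ν : Circle) : ℂ).re *
            ((Pi.single e' (1 : ℝ) : Edge d L → ℝ) (e.1, e.2) +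
              (Pi.single e' (1 : ℝ) : Edge d L → ℝ) (e.1.shift e.2, ν) -
              (Pi.single e' (1 : ℝ) : Edge d L → ℝ) (e.1.shift ν, e.2) -
              (Pi.single e' (1 : ℝ) : Edge d L → ℝ) (e.1, ν)))| ≤ 8 * ((d - 1 : ℕ) : ℝ) := by
  have hre : ∀ z : Circle, |((z : Circle) : ℂ).re| ≤ 1 := fun z =>
    (Complex.abs_re_le_norm _).trans_eq (Circle.norm_coe z)
  refine le_trans (Finset.sum_le_sum fun e _ => ?_) (sum_sum_abs_incidence_le e')
  refine (Finset.abs_sum_le_sum_abs _ _).trans (Finset.sum_le_sum fun ν _ => ?_)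
  exact abs_mul_sub_mul_le (hre _) (hre _)

/-- **`Σ_e |M_e(V)(e') − M_e(V')(e')| ≤ 32(d−1) · dist(V, V')`.** -/
theorem sum_abs_flowFieldEntry_sub_le (V V' : GaugeConfig d L Circle) (e' : Edge d L) :
    ∑ e : Edge d L, |(∑ ν ∈ Finset.univ.erase e.2,
        (((plaquetteHolonomy V (e.1 - Pi.single ν 1) e.2 ν : Circle) : ℂ).re *
            ((Pi.single e' (1 : ℝ) : Edge d L → ℝ) (e.1 - Pi.single ν 1, e.2) +
              (Pi.single e' (1 : ℝ) : Edge d L → ℝ) ((e.1 - Pi.single ν 1).shift e.2, ν) -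
              (Pi.single e' (1 : ℝ) : Edge d L → ℝ) ((e.1 - Pi.single ν 1).shift ν, e.2) -
              (Pi.single e' (1 : ℝ) : Edge d L → ℝ) (e.1 - Pi.single ν 1, ν)) -
          ((plaquetteHolonomy V e.1 e.2 ν : Circle) : ℂ).re *
            ((Pi.single e' (1 : ℝ) : Edge d L → ℝ) (e.1, e.2) +
              (Pi.single e' (1 : ℝ) : Edge d L → ℝ) (e.1.shift e.2, ν) -
              (Pi.single e' (1 : ℝ) : Edge d L → ℝ) (e.1.shift ν, e.2) -
              (Pi.single e' (1 : ℝ) : Edge d L → ℝ) (e.1, ν)))) -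
      ∑ ν ∈ Finset.univ.erase e.2,
        (((plaquetteHolonomy V' (e.1 - Pi.single ν 1) e.2 ν : Circle) : ℂ).re *
            ((Pi.single e' (1 : ℝ) : Edge d L → ℝ) (e.1 - Pi.single ν 1, e.2) +
              (Pi.single e' (1 : ℝ) : Edge d L → ℝ) ((e.1 - Pi.single ν 1).shift e.2, ν) -
              (Pi.single e' (1 : ℝ) : Edge d L → ℝ) ((e.1 - Pi.single ν 1).shift ν, e.2) -
              (Pi.single e' (1 : ℝ) : Edge d L → ℝ) (e.1 - Pi.single ν 1, ν)) -
          ((plaquetteHolonomy V' e.1 e.2 ν : Circle) : ℂ).re *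
            ((Pi.single e' (1 : ℝ) : Edge d L → ℝ) (e.1, e.2) +
              (Pi.single e' (1 : ℝ) : Edge d L → ℝ) (e.1.shift e.2, ν) -
              (Pi.single e' (1 : ℝ) : Edge d L → ℝ) (e.1.shift ν, e.2) -
              (Pi.single e' (1 : ℝ) : Edge d L → ℝ) (e.1, ν)))| ≤
      32 * ((d - 1 : ℕ) : ℝ) * dist V V' := by
  have hD : 0 ≤ dist V V' := dist_nonneg
  have hP : ∀ (x : Site d L) (i j : Fin d),
      |((plaquetteHolonomy V x i j : Circle) : ℂ).re - ((plaquetteHolonomy V' x i j : Circle) : ℂ).re| ≤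
        4 * dist V V' :=
    fun x i j => (abs_re_sub_re_le_dist _ _).trans (dist_plaquetteHolonomy_le V V' x i j)
  calc _ ≤ ∑ e : Edge d L, ∑ ν ∈ Finset.univ.erase e.2, 4 * dist V V' *
        (|(Pi.single e' (1 : ℝ) : Edge d L → ℝ) (e.1 - Pi.single ν 1, e.2) +
            (Pi.single e' (1 : ℝ) : Edge d L → ℝ) ((e.1 - Pi.single ν 1).shift e.2, ν) -
            (Pi.single e' (1 : ℝ) : Edge d L → ℝ) ((e.1 - Pi.single ν 1).shift ν, e.2) -
            (Pi.single e' (1 : ℝ) : Edge d L → ℝ) (e.1 - Pi.single ν 1, ν)| +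
          |(Pi.single e' (1 : ℝ) : Edge d L → ℝ) (e.1, e.2) +
            (Pi.single e' (1 : ℝ) : Edge d L → ℝ) (e.1.shift e.2, ν) -
            (Pi.single e' (1 : ℝ) : Edge d L → ℝ) (e.1.shift ν, e.2) -
            (Pi.single e' (1 : ℝ) : Edge d L → ℝ) (e.1, ν)|) := by
        refine Finset.sum_le_sum fun e _ => ?_
        rw [← Finset.sum_sub_distrib]
        refine (Finset.abs_sum_le_sum_abs _ _).trans (Finset.sum_le_sum fun ν _ => ?_)
        exact abs_sub_sub_sub_le (hP _ _ _) (hP _ _ _)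
    _ = 4 * dist V V' * _ := by
        rw [Finset.mul_sum]
        refine Finset.sum_congr rfl fun e _ => ?_
        rw [Finset.mul_sum]
    _ ≤ 4 * dist V V' * (8 * ((d - 1 : ℕ) : ℝ)) :=
        mul_le_mul_of_nonneg_left (sum_sum_abs_incidence_le e') (by positivity)
    _ = 32 * ((d - 1 : ℕ) : ℝ) * dist V V' := by ring

/-- **`Σ_e |N_e(V)(e')| ≤ 8(d−1)`.** -/
theorem sum_abs_factorEntry_le (V : GaugeConfig d L Circle) (e' : Edge d L) :
    ∑ e : Edge d L, |∑ ν ∈ Finset.univ.erase e.2,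
        (((plaquetteHolonomy V e.1 e.2 ν : Circle) : ℂ).im *
            ((Pi.single e' (1 : ℝ) : Edge d L → ℝ) (e.1, e.2) +
              (Pi.single e' (1 : ℝ) : Edge d L → ℝ) (e.1.shift e.2, ν) -
              (Pi.single e' (1 : ℝ) : Edge d L → ℝ) (e.1.shift ν, e.2) -
              (Pi.single e' (1 : ℝ) : Edge d L → ℝ) (e.1, ν)) +
          ((plaquetteHolonomy V (e.1 - Pi.single ν 1) e.2 ν : Circle) : ℂ).im *
            ((Pi.single e' (1 : ℝ) : Edge d L → ℝ) (e.1 - Pi.single ν 1, e.2) +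
              (Pi.single e' (1 : ℝ) : Edge d L → ℝ) ((e.1 - Pi.single ν 1).shift e.2, ν) -
              (Pi.single e' (1 : ℝ) : Edge d L → ℝ) ((e.1 - Pi.single ν 1).shift ν, e.2) -
              (Pi.single e' (1 : ℝ) : Edge d L → ℝ) (e.1 - Pi.single ν 1, ν)))| ≤ 8 * ((d - 1 : ℕ) : ℝ) := by
  refine le_trans (Finset.sum_le_sum fun e _ => ?_) (sum_sum_abs_incidence_le e')
  refine (Finset.abs_sum_le_sum_abs _ _).trans (Finset.sum_le_sum fun ν _ => ?_)
  exact abs_mul_add_mul_le (abs_im_coe_circle_le _) (abs_im_coe_circle_le _)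

/-- **`Σ_e |N_e(V)(e') − N_e(V')(e')| ≤ 32(d−1) · dist(V, V')`.** -/
theorem sum_abs_factorEntry_sub_le (V V' : GaugeConfig d L Circle) (e' : Edge d L) :
    ∑ e : Edge d L, |(∑ ν ∈ Finset.univ.erase e.2,
        (((plaquetteHolonomy V e.1 e.2 ν : Circle) : ℂ).im *
            ((Pi.single e' (1 : ℝ) : Edge d L → ℝ) (e.1, e.2) +
              (Pi.single e' (1 : ℝ) : Edge d L → ℝ) (e.1.shift e.2, ν) -
              (Pi.single e' (1 : ℝ) : Edge d L → ℝ) (e.1.shift ν, e.2) -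
              (Pi.single e' (1 : ℝ) : Edge d L → ℝ) (e.1, ν)) +
          ((plaquetteHolonomy V (e.1 - Pi.single ν 1) e.2 ν : Circle) : ℂ).im *
            ((Pi.single e' (1 : ℝ) : Edge d L → ℝ) (e.1 - Pi.single ν 1, e.2) +
              (Pi.single e' (1 : ℝ) : Edge d L → ℝ) ((e.1 - Pi.single ν 1).shift e.2, ν) -
              (Pi.single e' (1 : ℝ) : Edge d L → ℝ) ((e.1 - Pi.single ν 1).shift ν, e.2) -
              (Pi.single e' (1 : ℝ) : Edge d L → ℝ) (e.1 - Pi.single ν 1, ν)))) -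
      ∑ ν ∈ Finset.univ.erase e.2,
        (((plaquetteHolonomy V' e.1 e.2 ν : Circle) : ℂ).im *
            ((Pi.single e' (1 : ℝ) : Edge d L → ℝ) (e.1, e.2) +
              (Pi.single e' (1 : ℝ) : Edge d L → ℝ) (e.1.shift e.2, ν) -
              (Pi.single e' (1 : ℝ) : Edge d L → ℝ) (e.1.shift ν, e.2) -
              (Pi.single e' (1 : ℝ) : Edge d L → ℝ) (e.1, ν)) +
          ((plaquetteHolonomy V' (e.1 - Pi.single ν 1) e.2 ν : Circle) : ℂ).im *
            ((Pi.single e' (1 : ℝ) : Edge d L → ℝ) (e.1 - Pi.single ν 1, e.2) +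
              (Pi.single e' (1 : ℝ) : Edge d L → ℝ) ((e.1 - Pi.single ν 1).shift e.2, ν) -
              (Pi.single e' (1 : ℝ) : Edge d L → ℝ) ((e.1 - Pi.single ν 1).shift ν, e.2) -
              (Pi.single e' (1 : ℝ) : Edge d L → ℝ) (e.1 - Pi.single ν 1, ν)))| ≤
      32 * ((d - 1 : ℕ) : ℝ) * dist V V' := by
  have hD : 0 ≤ dist V V' := dist_nonneg
  have hP : ∀ (x : Site d L) (i j : Fin d),
      |((plaquetteHolonomy V x i j : Circle) : ℂ).im - ((plaquetteHolonomy V' x i j : Circle) : ℂ).im| ≤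
        4 * dist V V' :=
    fun x i j => (abs_im_sub_im_le_dist _ _).trans (dist_plaquetteHolonomy_le V V' x i j)
  calc _ ≤ ∑ e : Edge d L, ∑ ν ∈ Finset.univ.erase e.2, 4 * dist V V' *
        (|(Pi.single e' (1 : ℝ) : Edge d L → ℝ) (e.1 - Pi.single ν 1, e.2) +
            (Pi.single e' (1 : ℝ) : Edge d L → ℝ) ((e.1 - Pi.single ν 1).shift e.2, ν) -
            (Pi.single e' (1 : ℝ) : Edge d L → ℝ) ((e.1 - Pi.single ν 1).shift ν, e.2) -
            (Pi.single e' (1 : ℝ) : Edge d L → ℝ) (e.1 - Pi.single ν 1, ν)| +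
          |(Pi.single e' (1 : ℝ) : Edge d L → ℝ) (e.1, e.2) +
            (Pi.single e' (1 : ℝ) : Edge d L → ℝ) (e.1.shift e.2, ν) -
            (Pi.single e' (1 : ℝ) : Edge d L → ℝ) (e.1.shift ν, e.2) -
            (Pi.single e' (1 : ℝ) : Edge d L → ℝ) (e.1, ν)|) := by
        refine Finset.sum_le_sum fun e _ => ?_
        rw [← Finset.sum_sub_distrib]
        refine (Finset.abs_sum_le_sum_abs _ _).trans (Finset.sum_le_sum fun ν _ => ?_)
        exact abs_add_sub_add_le (hP _ _ _) (hP _ _ _)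
    _ = 4 * dist V V' * _ := by
        rw [Finset.mul_sum]
        refine Finset.sum_congr rfl fun e _ => ?_
        rw [Finset.mul_sum]
    _ ≤ 4 * dist V V' * (8 * ((d - 1 : ℕ) : ℝ)) :=
        mul_le_mul_of_nonneg_left (sum_sum_abs_incidence_le e') (by positivity)
    _ = 32 * ((d - 1 : ℕ) : ℝ) * dist V V' := by ring

end Entries

end Summit.Ventures.LatticeQCDFlow.Exactness
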